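import Summits.HodgeConjecture.HodgeConjecture.Theorems.HeckePrymWeilHeckePrymAnchorsUpgrade
import Literature.AlgebraicGeometry.HodgeTheory.WeilClassesSixfoldsProofs
import Literature.AlgebraicGeometry.Motives.AbelianVarietyCohomologyExteriorH1
import Summits.HodgeConjecture.HodgeConjecture.Theses.HeckePrymWeil
import HarnessLib

/-!
# Crux `WeilTwelvefoldsSqrtMinus7` ⟺ ONE non-zero algebraic Weil class per balanced `√-7`-twelvefold (unconditional)

Route `HeckePrymWeil` (sub-problem `HodgeConjecture`); lead seat c6 of crux `WeilTwelvefoldsSqrtMinus7`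
(stmt-HodgeConjecture-1261), line `isotypic-unimodular-saturation`, reshape r5.

"One class suffices" for the crux, UNCONDITIONALLY and as an EQUIVALENCE: the crux (every rational `(6,6)`
class of the typed Weil plane `Eig((𝟙+φ)^*, (1+i√7)¹²) ⊔ Eig((𝟙+φ)^*, (1-i√7)¹²)` of every complex abelian
twelvefold `(A, φ)` with `φ ≫ φ = -7` is algebraic) holds if and only if every such `(A, φ)` whose typed
Weil plane contains a non-zero rational `(6,6)` class (i.e. every BALANCED one, [Deligne1982HodgeCycles,
Prop. 4.4]) carries SOME non-zero algebraic class in its strong Weil plane `weilClassesOf A φ 6 7` — no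
rationality, no Hodge type asked of the witness (Markman arXiv:2509.23079 p. 2: "it suffices to prove the
algebraicity of one non-zero class in `HW(A, η)`, as `K` acts via algebraic correspondences"; van Geemen
LNM 1594, proof of Thm. 6.12).  Ingredients, all PROVED in the tree: the typing upgrade `stub_upgrade`
(typed plane ≤ strong plane; `b₁ = 2 dim` and the exterior structure of `H•(A(ℂ); ℂ)`), the Literature
theorem `weilClassesOf_le_algebraicClasses_iff_exists_ne_zero_of_dim_eq` (eigencomponents of an
algebraic class are algebraic since the test isogenies `x·𝟙 + y·φ` are flat; conjugation swaps the two
Weil LINES) and the named fact `Motives.abelianVarietyCohomologyExteriorH1`, PROVED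
(`abelianVarietyCohomologyExteriorH1_holds`).

* `weilTwelvefoldsSqrtMinus7_of_oneClass` — one non-zero algebraic strong Weil class on `(A, φ)` ⟹ the
  crux's conclusion on `(A, φ)` (pointwise, unconditional);
* `weilTwelvefoldsSqrtMinus7_iff_oneClassSuffices` — the registered sub-goal: crux ⟺ OneClass(7, 6).

No `sorry`, no new definition, no hypothesis beyond the statement.
-/

noncomputable section

-- every declaration of this problem lives in `Summit.HodgeConjecture.HodgeConjecture.…` (summit = sub-problem)
set_option linter.dupNamespace false

open CategoryTheory AlgebraicGeometry

namespace Summit.HodgeConjecture.HodgeConjecture.Theorems.HeckePrymWeilLine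

open Literature.AlgebraicGeometry Literature.AlgebraicGeometry.Motives Literature.AlgebraicGeometry.HodgeTheory
open Literature.AlgebraicTopology.SingularHomology
open Summit.HodgeConjecture.HodgeConjecture.Theses.HeckePrymWeil

/-- **One non-zero algebraic Weil class on `(A, φ)` gives the crux's conclusion on `(A, φ)`**
(UNCONDITIONAL, pointwise): if `A.dim = 12`, `φ ≫ φ = -7` and some non-zero class of the strong Weil
plane `weilClassesOf A φ 6 7` is algebraic, then EVERY class of the typed Weil plane of `(A, φ)` is
algebraic. [cite: vanGeemen1994HodgeAV, proof of Thm. 6.12] [cite: Deligne1982HodgeCycles, Prop. 4.4] -/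
theorem weilTwelvefoldsSqrtMinus7_of_oneClass
    (A : AbelianVariety ℂ) (φ : A ⟶ A) (hA : A.dim = 12) (hφ : φ ≫ φ = -((7 : ℤ) • 𝟙 A))
    (hex : ∃ u ∈ weilClassesOf A φ 6 7, u ∈ algebraicClasses A.X 6 ∧ u ≠ 0)
    (c : complexBetti A.X 12)
    (hc : c ∈ Module.End.eigenspace (complexBetti.map (𝟙 A + φ).hom.hom.hom 12).hom
            ((1 + Complex.I * (Real.sqrt (7 : ℝ) : ℂ)) ^ 12) ⊔
          Module.End.eigenspace (complexBetti.map (𝟙 A + φ).hom.hom.hom 12).hom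
            ((1 - Complex.I * (Real.sqrt (7 : ℝ) : ℂ)) ^ 12)) :
    c ∈ algebraicClasses A.X 6 := by
  have h7 : Nat.Prime 7 := by norm_num
  have hA' : A.dim = 2 * 6 := by rw [hA]
  have hφ' : φ ≫ φ = -(((7 : ℕ) : ℤ) • 𝟙 A) := by exact_mod_cast hφ
  have hφ'' : φ ≫ φ = -((7 : ℕ) • 𝟙 A) := by rw [hφ, ← natCast_zsmul]; rfl
  -- typing upgrade: the typed plane lies in the strong Weil plane of `(A, φ)`
  have hcW : c ∈ weilClassesOf A φ 6 7 :=
    stub_upgrade 7 h7 (by norm_num) le_rfl 6 A φ hA' hφ' (by exact_mod_cast hc)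
  -- one non-zero algebraic class makes the whole strong plane algebraic
  exact (weilClassesOf_le_algebraicClasses_iff_exists_ne_zero_of_dim_eq
    abelianVarietyCohomologyExteriorH1_holds hA' (by norm_num) (by norm_num) hφ'').mpr hex hcW

/-- **Crux `WeilTwelvefoldsSqrtMinus7` ⟺ ONE CLASS SUFFICES at `(7, 6)`** (UNCONDITIONAL equivalence): the
crux holds iff every complex abelian twelvefold `(A, φ)`, `φ ≫ φ = -7`, whose typed Weil plane contains a
non-zero rational `(6,6)` class carries some non-zero ALGEBRAIC class in its strong Weil plane
`weilClassesOf A φ 6 7`.  Forward: the crux makes that very class algebraic and `stub_upgrade` puts it in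
the strong plane.  Backward: `weilTwelvefoldsSqrtMinus7_of_oneClass` (the zero class is algebraic).
[cite: vanGeemen1994HodgeAV, proof of Thm. 6.12] [cite: Deligne1982HodgeCycles, Prop. 4.4] -/
theorem weilTwelvefoldsSqrtMinus7_iff_oneClassSuffices :
    WeilTwelvefoldsSqrtMinus7 ↔
    ∀ (A : AbelianVariety ℂ) (φ : A ⟶ A), A.dim = 12 → φ ≫ φ = -((7 : ℤ) • 𝟙 A) →
      (∃ c : complexBetti A.X 12, IsRationalClass c ∧ IsOfHodgeType 12 A.X 12 6 6 c ∧
        c ∈ Module.End.eigenspace (complexBetti.map (𝟙 A + φ).hom.hom.hom 12).hom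
              ((1 + Complex.I * (Real.sqrt (7 : ℝ) : ℂ)) ^ 12) ⊔
            Module.End.eigenspace (complexBetti.map (𝟙 A + φ).hom.hom.hom 12).hom
              ((1 - Complex.I * (Real.sqrt (7 : ℝ) : ℂ)) ^ 12) ∧ c ≠ 0) →
      ∃ u ∈ weilClassesOf A φ 6 7, u ∈ algebraicClasses A.X 6 ∧ u ≠ 0 := by
  constructor
  · intro h A φ hA hφ hbal
    obtain ⟨c, hrat, hH, hc, hc0⟩ := hbal
    have h7 : Nat.Prime 7 := by norm_num
    have hA' : A.dim = 2 * 6 := by rw [hA]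
    have hφ' : φ ≫ φ = -(((7 : ℕ) : ℤ) • 𝟙 A) := by exact_mod_cast hφ
    have hcW : c ∈ weilClassesOf A φ 6 7 :=
      stub_upgrade 7 h7 (by norm_num) le_rfl 6 A φ hA' hφ' (by exact_mod_cast hc)
    exact ⟨c, hcW, h A φ hA hφ c hrat hH hc, hc0⟩
  · intro h A φ hA hφ c hrat hH hc
    by_cases hc0 : c = 0
    · rw [hc0]
      exact Submodule.zero_mem _
    exact weilTwelvefoldsSqrtMinus7_of_oneClass A φ hA hφ (h A φ hA hφ ⟨c, hrat, hH, hc, hc0⟩) c hc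

end Summit.HodgeConjecture.HodgeConjecture.Theorems.HeckePrymWeilLine

end
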